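import Summits.QuantumFields.YangMills.Theorems.BalabanUVNodesN19SingleModeMultiscale

/-!
# YM-DAG node N19 (= NE7 proper) — MULTISCALE TELESCOPING, PART 2: THE SINGLE MODE OF THE ℓ¹-NORM — `e^{iωΣ_{i≤d}|x_i|}` is within
# `(J + 1 + 4ωd)∕2^J` of a pair of real `MvPolynomial`s of total degree `≤ (J+1)(2^{J+2} + 150ωd)`: `dist_∞(e^{iωS_d}, Π_t) ≲ (ωd∕t)·log t`
# UNIFORMLY IN THE NUMBER OF STRINGS `d`

Cell `pub-ymgap`, HUMAN RULING D-0062 (Track A) ∕ D-0149 (work-bound push), R141 (C) wider-strategy seat `pub-ymgap-dag-n19-e` (strategy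
s3 = ALTERNATIVE CURRENCY), generation g30, module 2 (lineage module 119).  Route `Summits/QuantumFields/YangMills/Theses/BalabanUVNodes.lean`,
cluster item K3⁸ «SpineGivenEndpointR13SepCoPHV» (stmt-QuantumFields-27366); filed `--supports` that item `--as helper` (it proves no registered
stub).  COUNT-NEUTRAL: [folklore] approximation theory over Mathlib and the lineage BY NAME — PART 1 `…N19SingleModeMultiscale` (the step and the
ladder), module 111 `…N19JointLawPriceCompositionsLipschitz` (`exists_jacksonPoly_near`: Jackson polynomial of `|·|`, degree `≤ 2M`, error `π∕M`), module
117 `…N19JacksonAbsolutePowers` (`eval_plantIn`, `totalDegree_plantIn_le`); no laws, no scheme object, no Theses import; NOT a discharge claim.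

CONTENT.  §1 `exists_additiveJackson` (`A_M = Σ_i p_M(X_i)`: `|Σ_i|x_i| − A_M(x)| ≤ dπ∕M` at total degree `2M`) · `abs_l1Norm_sub_half_le` ·
★★ `exists_pair_near_cexp_l1Norm_ladder` (PARAMETRIC in `J, h`: the ladder of PART 1 on the Jackson levels `M = 2^l`, `l ≤ J`, increments
`B_0 = A_0 − d∕2` (`R_0 = d(½ + π)`), `B_l = A_l − A_{l−1}` (`R_l = 3dπ∕2^l`), Taylor orders `⌈e²ωR_l⌉ + h`, base phase `ωd∕2`, tail `ωdπ∕2^J`: total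
degree `≤ 2e²ωd(½ + π + 3πJ) + 2h(2^{J+1} − 1)`, error `≤ 2(J+1)e^{−h} + ωdπ∕2^J`) · ★★★ `exists_pair_near_cexp_l1Norm` (`h = J + 1`: total degree
`≤ (J+1)(2^{J+2} + 150ωd)`, error `≤ (J + 1 + 4ωd)∕2^J`, for EVERY `J`) · ★★ `exists_mvPolynomial_near_cos_l1Norm` ∕ `…_sin_…` (real faces) ·
★★ `exists_pair_near_cexp_l1Norm_of_le` (`150ωd ≤ 2^{J+2}`: degree `≤ (J+1)2^{J+3} =: t`, error `≤ 8(J+1)(J+1+4ωd)∕t ≤ 8log₂t·(log₂t + 4ωd)∕t`).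
READING for (v′) (honest): the single mode of the ℓ¹-norm of `d` strings costs `≲ (ωd + log t)·log t∕t` at total degree `t` — LINEAR in `d`, the
numerics' `ψ(c′) ≈ 0.2c′` up to one `log t`, non-trivial in the whole range `ωd ≲ t∕log t` (before: `ωd ≲ log t`); by linearity every
trigonometric-polynomial link `Σ_n c_n e^{iω_nS}` costs `≲ Σ_n|c_n|(ω_n d + log t)log t∕t`.  It does NOT settle (v′): Fourier synthesis of a GENERAL
1-Lipschitz link loses `√t` (`Σ_{n≤t}|ĥ′(n)| ≲ √t`; OPEN-PROBLEM.md dead-end list), and the `log t` is the scheme's (`≍ log₂(ωd)` oscillating scales at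
`≍ 6e²π·ωd` each), not known to be necessary.

HONEST FRAMING (binding).  Elementary and [folklore]; ONE-SIDED (upper bounds); NO consumer in the DAG today (an optimality map of the seat's own
currency, degree model); nothing of Bałaban's instantiated; NE7 NOT PRINTED, NOT proved; N19 NOT discharged; count-neutral.  One finite `T⁴` programme
at fixed `ε`; nothing continuum ∕ `ℝ⁴` ∕ OS ∕ mass-gap ∕ Clay.  0 `def` ∕ 0 `sorry`.
-/

noncomputable section

open Finset Complex
open scoped Real

namespace Summit.QuantumFields.YangMills.Theorems.BalabanUVNodesN19SingleModeL1Norm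

open Summit.QuantumFields.YangMills.Theorems.BalabanUVNodesN19JointLawPriceCompositionsLipschitz (exists_jacksonPoly_near)
open Summit.QuantumFields.YangMills.Theorems.BalabanUVNodesN19JacksonAbsolutePowers (eval_plantIn totalDegree_plantIn_le)
open Summit.QuantumFields.YangMills.Theorems.BalabanUVNodesN19SingleModeMultiscale

variable {ι : Type*} [Fintype ι]


/-! ## §1 The Jackson ladder of the ℓ¹-norm and the single mode [folklore] -/

/-- **THE ADDITIVE JACKSON APPROXIMANT OF THE ℓ¹-NORM.**  For `M ≥ 1` there is a real `MvPolynomial` `A_M = Σ_i p_M(X_i)` of total degree `≤ 2M`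
with `|Σ_i|x_i| − A_M(x)| ≤ d·π∕M` on `[−1,1]^ι` (`d = |ι|`; module 111's Jackson polynomial of `|·|` planted in each coordinate). [folklore] -/
theorem exists_additiveJackson {M : ℕ} (hM : 0 < M) :
    ∃ A : MvPolynomial ι ℝ, A.totalDegree ≤ 2 * M ∧
      ∀ x : ι → ℝ, (∀ i, x i ∈ Set.Icc (-1 : ℝ) 1) →
        |(∑ i, |x i|) - MvPolynomial.eval x A| ≤ Fintype.card ι * (π / M) := by
  have hK : ∀ u v : ℝ, u ∈ Set.Icc (-1 : ℝ) 1 → v ∈ Set.Icc (-1 : ℝ) 1 → |abs u - abs v| ≤ 1 * |u - v| :=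
    fun u v _ _ => by rw [one_mul]; exact abs_abs_sub_abs_le_abs_sub u v
  have hG : ∀ u : ℝ, u ∈ Set.Icc (-1 : ℝ) 1 → |abs u| ≤ 1 := fun u hu => by
    rw [abs_abs]; exact abs_le.2 ⟨hu.1, hu.2⟩
  obtain ⟨q, hqdeg, hqerr, -, -⟩ := exists_jacksonPoly_near zero_le_one hK hG hM
  refine ⟨∑ i, ∑ k ∈ range (q.natDegree + 1), MvPolynomial.C (q.coeff k) * (MvPolynomial.X i) ^ k, ?_, ?_⟩
  · refine MvPolynomial.totalDegree_finsetSum_le fun i _ => (totalDegree_plantIn_le q _).trans ?_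
    rw [MvPolynomial.totalDegree_X, mul_one]; exact hqdeg
  · intro x hx
    have hsum : MvPolynomial.eval x (∑ i, ∑ k ∈ range (q.natDegree + 1), MvPolynomial.C (q.coeff k) * (MvPolynomial.X i) ^ k) =
        ∑ i, q.eval (x i) := by
      rw [map_sum]
      exact Finset.sum_congr rfl fun i _ => by rw [eval_plantIn, MvPolynomial.eval_X]
    rw [hsum, ← Finset.sum_sub_distrib]
    calc |∑ i, (|x i| - q.eval (x i))| ≤ ∑ i, |(|x i| - q.eval (x i))| := abs_sum_le_sum_abs _ _
      _ ≤ ∑ _i : ι, 1 * (π / M) := Finset.sum_le_sum fun i _ => hqerr _ (hx i)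
      _ = Fintype.card ι * (π / M) := by rw [sum_const, card_univ, nsmul_eq_mul, one_mul]

/-- The ℓ¹-norm lies in `[0, d]` on the cube. [bookkeeping] -/
theorem abs_l1Norm_sub_half_le (x : ι → ℝ) (hx : ∀ i, x i ∈ Set.Icc (-1 : ℝ) 1) :
    |(∑ i, |x i|) - Fintype.card ι / 2| ≤ Fintype.card ι / 2 := by
  have h0 : 0 ≤ ∑ i, |x i| := Finset.sum_nonneg fun i _ => abs_nonneg _
  have h1 : ∑ i, |x i| ≤ Fintype.card ι := by
    calc ∑ i, |x i| ≤ ∑ _i : ι, (1 : ℝ) := Finset.sum_le_sum fun i _ => abs_le.2 ⟨(hx i).1, (hx i).2⟩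
      _ = Fintype.card ι := by rw [sum_const, card_univ, nsmul_eq_mul, mul_one]
  rw [abs_le]; constructor <;> linarith

/-- ★★ **THE SINGLE MODE BY MULTISCALE TELESCOPING — PARAMETRIC FORM.**  For `ω ≥ 0`, `J : ℕ` and `h ≥ 1` with `(J+1)e^{−h} ≤ ½` there is a pair of
real `MvPolynomial`s `(Cr, Ci)` of total degree `≤ 2e²·ωd·(½ + π + 3πJ) + 2h·(2^{J+1} − 1)` with
`‖Cr(x) + Ci(x)·i − e^{iωΣ_i|x_i|}‖ ≤ 2(J+1)e^{−h} + ωdπ∕2^J` on `[−1,1]^ι` (`d = |ι|`).  The ladder: `A_l` = the additive Jackson approximant with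
`M = 2^l` (`l = 0,…,J`), increments `B_0 = A_0 − d∕2` (`R_0 = d(½ + π)`), `B_l = A_l − A_{l−1}` (`R_l = 3dπ∕2^l`), degrees `2^{l+1}`, Taylor orders
`n_l = ⌈e²ωR_l⌉ + h` (tails `≤ e^{−h}`), base phase `ωd∕2`; `Σ_{l≤J}B_l = A_J − d∕2` and `‖e^{iωA_J} − e^{iωS}‖ ≤ ωdπ∕2^J`. [folklore] -/
theorem exists_pair_near_cexp_l1Norm_ladder {ω : ℝ} (hω : 0 ≤ ω) (J h : ℕ) (hh : 1 ≤ h)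
    (hJh : ((J : ℝ) + 1) * Real.exp (-(h : ℝ)) ≤ 1 / 2) :
    ∃ Cr Ci : MvPolynomial ι ℝ,
      (Cr.totalDegree : ℝ) ≤ 2 * Real.exp 2 * ω * Fintype.card ι * (1 / 2 + π + 3 * π * J) + 2 * h * (2 ^ (J + 1) - 1) ∧
      (Ci.totalDegree : ℝ) ≤ 2 * Real.exp 2 * ω * Fintype.card ι * (1 / 2 + π + 3 * π * J) + 2 * h * (2 ^ (J + 1) - 1) ∧
      ∀ x : ι → ℝ, (∀ i, x i ∈ Set.Icc (-1 : ℝ) 1) →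
        ‖((MvPolynomial.eval x Cr : ℝ) : ℂ) + ((MvPolynomial.eval x Ci : ℝ) : ℂ) * I - exp (((ω * ∑ i, |x i| : ℝ) : ℂ) * I)‖ ≤
          2 * ((J : ℝ) + 1) * Real.exp (-(h : ℝ)) + ω * Fintype.card ι * π / 2 ^ J := by
  set d : ℝ := (Fintype.card ι : ℝ) with hd
  have hd0 : 0 ≤ d := Nat.cast_nonneg _
  -- the Jackson ladder
  choose A hAdeg hAerr using fun l : ℕ => exists_additiveJackson (ι := ι) (M := 2 ^ l) (pow_pos two_pos l)
  -- increments, bounds, degrees, Taylor orders (opaque names with defining equations)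
  obtain ⟨A', hA'0, hA's⟩ : ∃ A' : ℕ → MvPolynomial ι ℝ, A' 0 = MvPolynomial.C (d / 2) ∧ ∀ l, A' (l + 1) = A l :=
    ⟨fun l => if l = 0 then MvPolynomial.C (d / 2) else A (l - 1), if_pos rfl, fun l => by
      show (if l + 1 = 0 then MvPolynomial.C (d / 2) else A (l + 1 - 1)) = A l
      rw [if_neg (Nat.succ_ne_zero l), Nat.add_sub_cancel]⟩
  obtain ⟨B, hB⟩ : ∃ B : ℕ → MvPolynomial ι ℝ, ∀ l, B l = A l - A' l := ⟨fun l => A l - A' l, fun l => rfl⟩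
  obtain ⟨R, hR0', hRs⟩ : ∃ R : ℕ → ℝ, R 0 = d * (1 / 2 + π) ∧ ∀ l, R (l + 1) = 3 * d * π / 2 ^ (l + 1) :=
    ⟨fun l => if l = 0 then d * (1 / 2 + π) else 3 * d * π / 2 ^ l, if_pos rfl, fun l => if_neg (Nat.succ_ne_zero l)⟩
  obtain ⟨m, hm⟩ : ∃ m : ℕ → ℕ, ∀ l, m l = 2 * 2 ^ l := ⟨fun l => 2 * 2 ^ l, fun l => rfl⟩
  obtain ⟨n, hn⟩ : ∃ n : ℕ → ℕ, ∀ l, n l = ⌈Real.exp 2 * (ω * R l)⌉₊ + h := ⟨fun l => ⌈Real.exp 2 * (ω * R l)⌉₊ + h, fun l => rfl⟩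
  have hR0 : ∀ l, 0 ≤ R l := by
    intro l
    cases l with
    | zero => rw [hR0']; positivity
    | succ l => rw [hRs]; positivity
  -- hypotheses of the ladder
  have hdegB : ∀ l, l < J + 1 → (B l).totalDegree ≤ m l := by
    intro l _
    rw [hB, hm]
    refine (MvPolynomial.totalDegree_sub _ _).trans (max_le ((hAdeg l).trans le_rfl) ?_)
    cases l with
    | zero => rw [hA'0, MvPolynomial.totalDegree_C]; exact Nat.zero_le _
    | succ l =>
      rw [hA's]
      exact (hAdeg l).trans (Nat.mul_le_mul_left _ (Nat.pow_le_pow_right two_pos (Nat.le_succ l)))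
  have hRB : ∀ l, l < J + 1 → ∀ x : ι → ℝ, (∀ i, x i ∈ Set.Icc (-1 : ℝ) 1) → |MvPolynomial.eval x (B l)| ≤ R l := by
    intro l _ x hx
    rw [hB, map_sub]
    cases l with
    | zero =>
      rw [hA'0, hR0', MvPolynomial.eval_C]
      have h1 := hAerr 0 x hx
      have h2 := abs_l1Norm_sub_half_le x hx
      rw [pow_zero, Nat.cast_one, div_one] at h1
      calc |MvPolynomial.eval x (A 0) - d / 2|
          ≤ |MvPolynomial.eval x (A 0) - (∑ i, |x i|)| + |(∑ i, |x i|) - d / 2| := abs_sub_le _ _ _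
        _ ≤ d * π + d / 2 := by rw [abs_sub_comm] at h1; exact add_le_add h1 h2
        _ = d * (1 / 2 + π) := by ring
    | succ l =>
      rw [hA's, hRs]
      have h1 := hAerr (l + 1) x hx
      have h2 := hAerr l x hx
      calc |MvPolynomial.eval x (A (l + 1)) - MvPolynomial.eval x (A l)|
          ≤ |MvPolynomial.eval x (A (l + 1)) - (∑ i, |x i|)| + |(∑ i, |x i|) - MvPolynomial.eval x (A l)| := abs_sub_le _ _ _
        _ ≤ d * (π / (2 ^ (l + 1) : ℕ)) + d * (π / (2 ^ l : ℕ)) := by rw [abs_sub_comm] at h1; exact add_le_add h1 h2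
        _ = 3 * d * π / 2 ^ (l + 1) := by push_cast; rw [pow_succ]; field_simp; ring
  have hnl : ∀ l, l < J + 1 → 1 ≤ n l ∧ Real.exp 2 * (ω * R l) ≤ n l := by
    intro l _
    rw [hn]
    refine ⟨hh.trans (Nat.le_add_left h _), ?_⟩
    push_cast
    exact (Nat.le_ceil _).trans (le_add_of_nonneg_right (Nat.cast_nonneg _))
  have hηl : ∀ l, Real.exp (ω * R l - n l) ≤ Real.exp (-(h : ℝ)) := by
    intro l
    refine Real.exp_le_exp.2 ?_
    rw [hn]; push_cast
    have h1 : ω * R l ≤ Real.exp 2 * (ω * R l) := by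
      have : (1 : ℝ) ≤ Real.exp 2 := Real.one_le_exp (by norm_num)
      nlinarith [mul_nonneg hω (hR0 l)]
    have h2 := Nat.le_ceil (Real.exp 2 * (ω * R l))
    linarith
  have hηsum : ∑ l ∈ range (J + 1), Real.exp (ω * R l - n l) ≤ ((J : ℝ) + 1) * Real.exp (-(h : ℝ)) := by
    calc ∑ l ∈ range (J + 1), Real.exp (ω * R l - n l) ≤ ∑ _l ∈ range (J + 1), Real.exp (-(h : ℝ)) :=
          Finset.sum_le_sum fun l _ => hηl l
      _ = ((J : ℝ) + 1) * Real.exp (-(h : ℝ)) := by rw [sum_const, card_range, nsmul_eq_mul]; push_cast; ring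
  -- the ladder
  obtain ⟨Cr, Ci, hCr, hCi, happ⟩ := exists_pair_near_cexp_sum (ι := ι) (ω * (d / 2)) hω B m n R (J + 1) hdegB hRB hnl
    (hηsum.trans hJh)
  -- degree bookkeeping
  have hRm0 : R 0 * (m 0 : ℝ) = 2 * d * (1 / 2 + π) := by
    rw [hR0', hm]; push_cast; ring
  have hRms : ∀ l, R (l + 1) * (m (l + 1) : ℝ) = 6 * d * π := by
    intro l
    rw [hRs, hm]; push_cast
    have h2 : (2 : ℝ) ^ (l + 1) ≠ 0 := pow_ne_zero _ two_ne_zero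
    field_simp
    ring
  have hsumRm : ∑ l ∈ range (J + 1), R l * (m l : ℝ) = 2 * d * (1 / 2 + π) + 6 * d * π * J := by
    rw [Finset.sum_range_succ', hRm0, Finset.sum_congr rfl fun l _ => hRms l, sum_const, card_range, nsmul_eq_mul]
    ring
  have hsumm : ∑ l ∈ range (J + 1), (m l : ℝ) = 2 * (2 ^ (J + 1) - 1) := by
    have hg := geom_sum_eq (x := (2 : ℝ)) (by norm_num) (J + 1)
    rw [Finset.sum_congr rfl fun l _ => show (m l : ℝ) = 2 * 2 ^ l by rw [hm]; push_cast; ring, ← Finset.mul_sum, hg]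
    ring
  have hdeg : ((∑ l ∈ range (J + 1), (n l - 1) * m l : ℕ) : ℝ) ≤
      2 * Real.exp 2 * ω * d * (1 / 2 + π + 3 * π * J) + 2 * h * (2 ^ (J + 1) - 1) := by
    push_cast
    have hterm : ∀ l ∈ range (J + 1), (((n l - 1 : ℕ) : ℝ)) * (m l : ℝ) ≤ (Real.exp 2 * ω) * (R l * m l) + h * (m l : ℝ) := by
      intro l hl
      have hn1 : 1 ≤ n l := (hnl l (mem_range.1 hl)).1
      have hcast : ((n l - 1 : ℕ) : ℝ) = (⌈Real.exp 2 * (ω * R l)⌉₊ : ℝ) + h - 1 := by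
        rw [Nat.cast_sub hn1, hn]; push_cast; ring
      have hceil : (⌈Real.exp 2 * (ω * R l)⌉₊ : ℝ) < Real.exp 2 * (ω * R l) + 1 :=
        Nat.ceil_lt_add_one (mul_nonneg (Real.exp_pos _).le (mul_nonneg hω (hR0 l)))
      have hm0 : (0 : ℝ) ≤ m l := Nat.cast_nonneg _
      rw [hcast]
      nlinarith
    calc ∑ l ∈ range (J + 1), ((n l - 1 : ℕ) : ℝ) * (m l : ℝ)
        ≤ ∑ l ∈ range (J + 1), ((Real.exp 2 * ω) * (R l * m l) + h * (m l : ℝ)) := Finset.sum_le_sum hterm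
      _ = (Real.exp 2 * ω) * ∑ l ∈ range (J + 1), R l * (m l : ℝ) + h * ∑ l ∈ range (J + 1), (m l : ℝ) := by
          rw [Finset.sum_add_distrib, Finset.mul_sum, Finset.mul_sum]
      _ = 2 * Real.exp 2 * ω * d * (1 / 2 + π + 3 * π * J) + 2 * h * (2 ^ (J + 1) - 1) := by
          rw [hsumRm, hsumm]; ring
  refine ⟨Cr, Ci, (Nat.cast_le.2 hCr).trans hdeg, (Nat.cast_le.2 hCi).trans hdeg, fun x hx => ?_⟩
  -- the phase telescopes to `ω·A_J(x)`
  have htel : ω * (d / 2) + ω * ∑ l ∈ range (J + 1), MvPolynomial.eval x (B l) = ω * MvPolynomial.eval x (A J) := by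
    have hsumB : ∑ l ∈ range (J + 1), MvPolynomial.eval x (B l) = MvPolynomial.eval x (A J) - d / 2 := by
      have hsub : ∀ l, MvPolynomial.eval x (B l) = MvPolynomial.eval x (A l) - MvPolynomial.eval x (A' l) := fun l => by
        rw [hB, map_sub]
      simp only [hsub, Finset.sum_sub_distrib]
      rw [Finset.sum_range_succ (fun l => MvPolynomial.eval x (A l)), Finset.sum_range_succ' (fun l => MvPolynomial.eval x (A' l))]
      have hxA'0 : MvPolynomial.eval x (A' 0) = d / 2 := by rw [hA'0, MvPolynomial.eval_C]
      have hxA's : ∀ l, MvPolynomial.eval x (A' (l + 1)) = MvPolynomial.eval x (A l) := fun l => by rw [hA's]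
      simp only [hxA'0, hxA's]
      ring
    rw [hsumB]; ring
  have happ' := happ x hx
  rw [htel] at happ'
  have htail : ‖exp (((ω * MvPolynomial.eval x (A J) : ℝ) : ℂ) * I) - exp (((ω * ∑ i, |x i| : ℝ) : ℂ) * I)‖ ≤ ω * d * π / 2 ^ J := by
    refine (norm_cexp_sub_cexp_le _ _).trans ?_
    rw [← mul_sub, abs_mul, abs_of_nonneg hω, abs_sub_comm, mul_assoc, mul_div_assoc]
    refine mul_le_mul_of_nonneg_left ?_ hω
    have := hAerr J x hx
    push_cast at this
    calc |(∑ i, |x i|) - MvPolynomial.eval x (A J)| ≤ d * (π / 2 ^ J) := this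
      _ = d * π / 2 ^ J := by ring
  calc ‖((MvPolynomial.eval x Cr : ℝ) : ℂ) + ((MvPolynomial.eval x Ci : ℝ) : ℂ) * I - exp (((ω * ∑ i, |x i| : ℝ) : ℂ) * I)‖
      = ‖(((MvPolynomial.eval x Cr : ℝ) : ℂ) + ((MvPolynomial.eval x Ci : ℝ) : ℂ) * I -
            exp (((ω * MvPolynomial.eval x (A J) : ℝ) : ℂ) * I)) +
          (exp (((ω * MvPolynomial.eval x (A J) : ℝ) : ℂ) * I) - exp (((ω * ∑ i, |x i| : ℝ) : ℂ) * I))‖ := by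
        rw [sub_add_sub_cancel]
    _ ≤ _ := norm_add_le _ _
    _ ≤ 2 * (((J : ℝ) + 1) * Real.exp (-(h : ℝ))) + ω * d * π / 2 ^ J := by
        refine add_le_add (happ'.trans ?_) htail
        exact mul_le_mul_of_nonneg_left hηsum zero_le_two
    _ = 2 * ((J : ℝ) + 1) * Real.exp (-(h : ℝ)) + ω * d * π / 2 ^ J := by ring

/-- ★★★ **THE SINGLE MODE OF THE ℓ¹-NORM OF `d` STRINGS: TOTAL DEGREE `≤ (J+1)(2^{J+2} + 150ωd)`, ERROR `≤ (J + 1 + 4ωd)∕2^J`, FOR EVERY `J`.**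
For `ω ≥ 0` and every `J : ℕ` there is a pair of real `MvPolynomial`s `(Cr, Ci)` with total degrees `≤ (J+1)(2^{J+2} + 150ωd)` and
`‖Cr(x) + Ci(x)·i − e^{iωΣ_i|x_i|}‖ ≤ (J + 1 + 4ωd)∕2^J` on `[−1,1]^ι` (`d = |ι|`): the parametric form at `h = J + 1` with the numerals
`2e²(½ + π) ≤ 150`, `6e²π ≤ 150`, `2(J+1)e^{−(J+1)} ≤ (J+1)2^{−J}`, `π ≤ 4`.  READING (degree model of (v′)): at total degree `t = (J+1)2^{J+3}` with
`150ωd ≤ 2^{J+2}` the error is `≤ 8(J+1)(J+1+4ωd)∕t ≤ 8log₂t·(log₂t + 4ωd)∕t` — `dist_∞(e^{iωS_d}, Π_t) ≲ (ωd + log t)log t∕t`, LINEAR IN `d`, against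
nesting's `≍ ω²d²∕t` and the device's `≍ e^{ωd}∕t`. [folklore] -/
theorem exists_pair_near_cexp_l1Norm {ω : ℝ} (hω : 0 ≤ ω) (J : ℕ) :
    ∃ Cr Ci : MvPolynomial ι ℝ,
      (Cr.totalDegree : ℝ) ≤ ((J : ℝ) + 1) * (2 ^ (J + 2) + 150 * ω * Fintype.card ι) ∧
      (Ci.totalDegree : ℝ) ≤ ((J : ℝ) + 1) * (2 ^ (J + 2) + 150 * ω * Fintype.card ι) ∧
      ∀ x : ι → ℝ, (∀ i, x i ∈ Set.Icc (-1 : ℝ) 1) →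
        ‖((MvPolynomial.eval x Cr : ℝ) : ℂ) + ((MvPolynomial.eval x Ci : ℝ) : ℂ) * I - exp (((ω * ∑ i, |x i| : ℝ) : ℂ) * I)‖ ≤
          ((J : ℝ) + 1 + 4 * ω * Fintype.card ι) / 2 ^ J := by
  set d : ℝ := (Fintype.card ι : ℝ) with hd
  have hd0 : 0 ≤ d := Nat.cast_nonneg _
  have hJ0 : (0 : ℝ) ≤ J := Nat.cast_nonneg _
  -- numerals
  have he1 : (2 : ℝ) ≤ Real.exp 1 := by have := Real.exp_one_gt_d9; linarith
  have he2 : Real.exp 2 ≤ 7.4 := by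
    have h1 := Real.exp_one_lt_d9
    have : Real.exp 2 = Real.exp 1 * Real.exp 1 := by rw [← Real.exp_add]; norm_num
    rw [this]; nlinarith [Real.exp_pos 1]
  have hπ : π ≤ 3.15 := Real.pi_lt_d2.le
  have hπ4 : π ≤ 4 := Real.pi_le_four
  -- `(J+1)e^{-(J+1)} ≤ ½` and `2e^{-(J+1)} ≤ 2^{-J}`
  have hexpJ : (2 : ℝ) ^ (J + 1) ≤ Real.exp ((J : ℝ) + 1) := by
    have : Real.exp ((J : ℝ) + 1) = Real.exp 1 ^ (J + 1) := by
      rw [Real.exp_one_pow (J + 1)]; norm_cast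
    rw [this]; exact pow_le_pow_left₀ zero_le_two he1 _
  have hJexp : 2 * ((J : ℝ) + 1) ≤ Real.exp ((J : ℝ) + 1) := by
    have h1 : (J : ℝ) + 1 ≤ Real.exp (J : ℝ) := by have := Real.add_one_le_exp (J : ℝ); linarith
    have h2 : Real.exp ((J : ℝ) + 1) = Real.exp (J : ℝ) * Real.exp 1 := by rw [← Real.exp_add]
    rw [h2]; nlinarith [Real.exp_pos (J : ℝ)]
  have hexp_neg : Real.exp (-((J + 1 : ℕ) : ℝ)) = (Real.exp ((J : ℝ) + 1))⁻¹ := by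
    rw [Real.exp_neg]; push_cast; ring_nf
  have hEpos : 0 < Real.exp ((J : ℝ) + 1) := Real.exp_pos _
  have hJh : ((J : ℝ) + 1) * Real.exp (-((J + 1 : ℕ) : ℝ)) ≤ 1 / 2 := by
    rw [hexp_neg, ← div_eq_mul_inv, div_le_iff₀ hEpos]; linarith
  obtain ⟨Cr, Ci, hCr, hCi, happ⟩ := exists_pair_near_cexp_l1Norm_ladder (ι := ι) hω J (J + 1) le_add_self hJh
  have hdeg : 2 * Real.exp 2 * ω * d * (1 / 2 + π + 3 * π * J) + 2 * ((J + 1 : ℕ) : ℝ) * (2 ^ (J + 1) - 1) ≤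
      ((J : ℝ) + 1) * (2 ^ (J + 2) + 150 * ω * d) := by
    have h1 : 2 * Real.exp 2 * (1 / 2 + π + 3 * π * J) ≤ 150 * ((J : ℝ) + 1) := by
      have hX : (0 : ℝ) ≤ 1 / 2 + π + 3 * π * J := by positivity
      have s1 : 2 * Real.exp 2 * (1 / 2 + π + 3 * π * J) ≤ 2 * 7.4 * (1 / 2 + π + 3 * π * J) := by
        nlinarith [mul_nonneg (sub_nonneg.2 he2) hX]
      have s2 : 1 / 2 + π + 3 * π * (J : ℝ) ≤ 3.65 + 9.45 * J := by
        nlinarith [mul_nonneg (sub_nonneg.2 hπ) hJ0]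
      nlinarith [s1, s2]
    have h2 : 2 * Real.exp 2 * ω * d * (1 / 2 + π + 3 * π * J) ≤ 150 * ((J : ℝ) + 1) * (ω * d) := by
      have := mul_le_mul_of_nonneg_right h1 (mul_nonneg hω hd0)
      linarith [this]
    have h3 : 2 * ((J + 1 : ℕ) : ℝ) * (2 ^ (J + 1) - 1) ≤ ((J : ℝ) + 1) * 2 ^ (J + 2) := by
      push_cast
      have e : ((J : ℝ) + 1) * 2 ^ (J + 2) - 2 * ((J : ℝ) + 1) * (2 ^ (J + 1) - 1) = 2 * ((J : ℝ) + 1) := by ring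
      linarith [e, hJ0]
    calc _ ≤ 150 * ((J : ℝ) + 1) * (ω * d) + ((J : ℝ) + 1) * 2 ^ (J + 2) := add_le_add h2 h3
      _ = ((J : ℝ) + 1) * (2 ^ (J + 2) + 150 * ω * d) := by ring
  refine ⟨Cr, Ci, hCr.trans hdeg, hCi.trans hdeg, fun x hx => (happ x hx).trans ?_⟩
  have h2J : (0 : ℝ) < 2 ^ J := by positivity
  have herr1 : 2 * ((J : ℝ) + 1) * Real.exp (-((J + 1 : ℕ) : ℝ)) ≤ ((J : ℝ) + 1) / 2 ^ J := by
    rw [hexp_neg, le_div_iff₀ h2J]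
    have : 2 * 2 ^ J * (Real.exp ((J : ℝ) + 1))⁻¹ ≤ 1 := by
      rw [← div_eq_mul_inv, div_le_one hEpos, ← pow_succ']; exact hexpJ
    calc 2 * ((J : ℝ) + 1) * (Real.exp ((J : ℝ) + 1))⁻¹ * 2 ^ J
        = ((J : ℝ) + 1) * (2 * 2 ^ J * (Real.exp ((J : ℝ) + 1))⁻¹) := by ring
      _ ≤ ((J : ℝ) + 1) * 1 := mul_le_mul_of_nonneg_left this (by linarith)
      _ = (J : ℝ) + 1 := mul_one _
  have herr2 : ω * d * π / 2 ^ J ≤ 4 * ω * d / 2 ^ J := by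
    rw [div_le_div_iff_of_pos_right h2J]
    calc ω * d * π ≤ ω * d * 4 := mul_le_mul_of_nonneg_left hπ4 (mul_nonneg hω hd0)
      _ = 4 * ω * d := by ring
  calc 2 * ((J : ℝ) + 1) * Real.exp (-((J + 1 : ℕ) : ℝ)) + ω * d * π / 2 ^ J
      ≤ ((J : ℝ) + 1) / 2 ^ J + 4 * ω * d / 2 ^ J := add_le_add herr1 herr2
    _ = ((J : ℝ) + 1 + 4 * ω * d) / 2 ^ J := by ring

/-- ★★ **REAL FACE: `cos(ωΣ_i|x_i|)`.**  For `ω ≥ 0` and every `J` there is `P : MvPolynomial ι ℝ` of total degree `≤ (J+1)(2^{J+2} + 150ωd)` with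
`|cos(ωΣ_i|x_i|) − P(x)| ≤ (J + 1 + 4ωd)∕2^J` on `[−1,1]^ι` (the real part of the pair; `|Re z| ≤ ‖z‖`).  In the language of OPEN-PROBLEM.md
reformulation 3: `dist_∞(cos(ωS_k), Π_t) ≲ (kω + log t)·log t∕t` for all `k, ω, t` — uniformly in `k`, up to one logarithm of the conjectured `ψ(kω∕t)`.
[folklore] -/
theorem exists_mvPolynomial_near_cos_l1Norm {ω : ℝ} (hω : 0 ≤ ω) (J : ℕ) :
    ∃ P : MvPolynomial ι ℝ, (P.totalDegree : ℝ) ≤ ((J : ℝ) + 1) * (2 ^ (J + 2) + 150 * ω * Fintype.card ι) ∧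
      ∀ x : ι → ℝ, (∀ i, x i ∈ Set.Icc (-1 : ℝ) 1) →
        |Real.cos (ω * ∑ i, |x i|) - MvPolynomial.eval x P| ≤ ((J : ℝ) + 1 + 4 * ω * Fintype.card ι) / 2 ^ J := by
  obtain ⟨Cr, Ci, hCr, -, happ⟩ := exists_pair_near_cexp_l1Norm (ι := ι) hω J
  refine ⟨Cr, hCr, fun x hx => ?_⟩
  have hre : (((MvPolynomial.eval x Cr : ℝ) : ℂ) + ((MvPolynomial.eval x Ci : ℝ) : ℂ) * I -
          exp (((ω * ∑ i, |x i| : ℝ) : ℂ) * I)).re = MvPolynomial.eval x Cr - Real.cos (ω * ∑ i, |x i|) := by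
    simp only [Complex.sub_re, Complex.add_re, Complex.mul_re, Complex.ofReal_re, Complex.ofReal_im, Complex.I_re,
      Complex.I_im, Complex.exp_ofReal_mul_I_re]
    ring
  rw [abs_sub_comm, ← hre]
  exact (Complex.abs_re_le_norm _).trans (happ x hx)

/-- ★★ **REAL FACE: `sin(ωΣ_i|x_i|)`** (the imaginary part of the pair). [folklore] -/
theorem exists_mvPolynomial_near_sin_l1Norm {ω : ℝ} (hω : 0 ≤ ω) (J : ℕ) :
    ∃ P : MvPolynomial ι ℝ, (P.totalDegree : ℝ) ≤ ((J : ℝ) + 1) * (2 ^ (J + 2) + 150 * ω * Fintype.card ι) ∧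
      ∀ x : ι → ℝ, (∀ i, x i ∈ Set.Icc (-1 : ℝ) 1) →
        |Real.sin (ω * ∑ i, |x i|) - MvPolynomial.eval x P| ≤ ((J : ℝ) + 1 + 4 * ω * Fintype.card ι) / 2 ^ J := by
  obtain ⟨Cr, Ci, -, hCi, happ⟩ := exists_pair_near_cexp_l1Norm (ι := ι) hω J
  refine ⟨Ci, hCi, fun x hx => ?_⟩
  have him : (((MvPolynomial.eval x Cr : ℝ) : ℂ) + ((MvPolynomial.eval x Ci : ℝ) : ℂ) * I -
          exp (((ω * ∑ i, |x i| : ℝ) : ℂ) * I)).im = MvPolynomial.eval x Ci - Real.sin (ω * ∑ i, |x i|) := by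
    simp only [Complex.sub_im, Complex.add_im, Complex.mul_im, Complex.ofReal_re, Complex.ofReal_im, Complex.I_re,
      Complex.I_im, Complex.exp_ofReal_mul_I_im]
    ring
  rw [abs_sub_comm, ← him]
  exact (Complex.abs_im_le_norm _).trans (happ x hx)

/-- ★★ **AT A DEGREE BUDGET OF THE FORM `t = (J+1)2^{J+3}`.**  For `ω ≥ 0` and `J` with `150ωd ≤ 2^{J+2}` there is a pair of real `MvPolynomial`s of
total degree `≤ (J+1)2^{J+3}` with `‖Cr(x) + Ci(x)·i − e^{iωΣ_i|x_i|}‖ ≤ (J + 1 + 4ωd)∕2^J` on the cube; with `t = (J+1)2^{J+3}` (so `2^{−J} = 8(J+1)∕t`,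
`J + 1 ≤ log₂t`): error `≤ 8log₂t·(log₂t + 4ωd)∕t`.  Since `Π_t ⊆ Π_{t′}` for `t ≤ t′` and consecutive admissible budgets differ by a factor `≤ 4`, the
same reading holds for every `t` with `32` in place of `8`. [folklore] -/
theorem exists_pair_near_cexp_l1Norm_of_le {ω : ℝ} (hω : 0 ≤ ω) {J : ℕ}
    (hJ : 150 * ω * Fintype.card ι ≤ 2 ^ (J + 2)) :
    ∃ Cr Ci : MvPolynomial ι ℝ, Cr.totalDegree ≤ (J + 1) * 2 ^ (J + 3) ∧ Ci.totalDegree ≤ (J + 1) * 2 ^ (J + 3) ∧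
      ∀ x : ι → ℝ, (∀ i, x i ∈ Set.Icc (-1 : ℝ) 1) →
        ‖((MvPolynomial.eval x Cr : ℝ) : ℂ) + ((MvPolynomial.eval x Ci : ℝ) : ℂ) * I - exp (((ω * ∑ i, |x i| : ℝ) : ℂ) * I)‖ ≤
          ((J : ℝ) + 1 + 4 * ω * Fintype.card ι) / 2 ^ J := by
  obtain ⟨Cr, Ci, hCr, hCi, happ⟩ := exists_pair_near_cexp_l1Norm (ι := ι) hω J
  have hbound : ((J : ℝ) + 1) * (2 ^ (J + 2) + 150 * ω * Fintype.card ι) ≤ ((J + 1) * 2 ^ (J + 3) : ℕ) := by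
    push_cast
    have hJ0 : (0 : ℝ) ≤ J := Nat.cast_nonneg _
    calc ((J : ℝ) + 1) * (2 ^ (J + 2) + 150 * ω * Fintype.card ι) ≤ ((J : ℝ) + 1) * (2 ^ (J + 2) + 2 ^ (J + 2)) :=
          mul_le_mul_of_nonneg_left (add_le_add le_rfl hJ) (by linarith)
      _ = ((J : ℝ) + 1) * 2 ^ (J + 3) := by ring
  exact ⟨Cr, Ci, Nat.cast_le.1 (hCr.trans hbound), Nat.cast_le.1 (hCi.trans hbound), happ⟩

end Summit.QuantumFields.YangMills.Theorems.BalabanUVNodesN19SingleModeL1Norm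

end
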